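import Summits.ValiantsHypothesis.ValiantsHypothesis.Theorems.GrenetZeonDualUnipotentThreeHalvesHeavyTopIrreducibleSThreeLemmas

/-!
# `GrenetZeon.DualUnipotentThreeHalves` (stmt-ValiantsHypothesis-24318), R2 heavy-top instrument — IRREDUCIBLE NILPOTENT SPACES:
# the orbit-cone family `S₃(m) ⊂ M_m(ℂ)`: `ι(m) ≥ C(m−2,2) + 2` for EVERY `m ≥ 4`, in ONE kernel theorem (part B: assembly + instances)

Experiment cell «val-heavytop-census» (D-0160), engine seat val-htc-eng-2 g3 (kernel-only lane; no compute).  `ι(m)` = the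
maximal dimension of an IRREDUCIBLE linear space of nilpotent `m × m` complex matrices (Mathes–Omladič–Radjavi 1991 §5); the
composition rows of the heavy-top table consume upper bounds on `ι` (✓ `heavyTopInst_five_eight_of_iota`), the census keeps the
certified lower bounds (CENSUS-GRID §0 B: kernel `ι(8) ≥ 13, ι(9) ≥ 19, ι(10) ≥ 21, ι(11) ≥ 26` before this file, one file of
symbolic powers per `m`).  THIS FILE proves, uniformly in `m = k + 4`, val-idea-29 g7's CLAIM ι (memo
`Cruxes/DualUnipotentThreeHalves/MEMO-idea29-g7-orbit-cone-species.md` §1; CONFIRMED on paper by val-idea-crit-7 g3,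
`CRITIC-V37-claim-iota-S3.md`, whose «KERNEL ROUTE» this is):

  `S₃(m) := 𝔫_mid ⊕ ℂ·c ⊕ ℂ·v`,  `c = E_{T,0} − E_{L,B}`,  `v = E_{L,T} + E_{B,0}`

(basis order `e_0, …, e_{k+1}` = Mid with `L := k+1`, then `e_T`, `T := k+2`, and `e_B`, `B := k+3`; the memo's order is
`e_T | Mid | e_B` — the statement is conjugation invariant).  The space is the range of the linear parametrisation
`f ↦ N(f) + α c + β v` (`α = f (inl 0)`, `β = f (inl 1)`, `N(f)_{ij} = f (inr (i,j))` for `i < j ≤ k+1`), which is injective, so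
`finrank = #(Fin 2 ⊕ {a<b in Fin (k+2)}) = C(k+2,2) + 2` (the count via the non-diagonal part of `Sym2`); nilpotency and irreducibility are part A's `pow_eq_zero_of_rows` and
`eq_bot_or_eq_top_of_stable` applied to the rows of `N(f) + α c + β v` and to the generators `c`, `v`, `E_{ab}`.

* ★ `exists_irreducible_nilpotent_finrank_sThree` — `∀ k, ∃ V ≤ M_{k+4}(ℂ)`, `finrank V = C(k+2,2) + 2`, all members nilpotent,
  no non-trivial proper invariant subspace (the `ι`-currency of ✓ `heavyTopInst_five_eight_of_iota`);
* `exists_irreducible_nilpotent_finrank_choose` — the same over `Fin m` for every `m ≥ 4`; `not_iota_le_choose` — the hypothesis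
  shape «`ι(m) ≤ C(m−2,2)+1`» is false for every `m ≥ 4`;
* instances `…_eight_seventeen` … `…_twelve_fortySeven` and `not_iota_8_le_16` … `not_iota_12_le_46` — new kernel column
  `ι(8) ≥ 17`, `ι(9) ≥ 23`, `ι(10) ≥ 30`, `ι(11) ≥ 38`, `ι(12) ≥ 47` (at `m = 5, 6, 7` the family ties the records `5, 8, 12`).

Honest framing: a lower-bound datum for the instrument (the memo's conjecture «`ι(m) = C(m−2,2)+2`» is NOT claimed); nothing
here proves or refutes `HeavyTopLaw`/`HeavyTopSlowLaw`, 24318, S3 or 8062; `VP ≠ VNP` is NOT proved.  No definitions.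
[val-idea-29 g7 (construction, paper proof); val-idea-crit-7 g3 V37 (check, kernel route); this seat (exact third leg `m ≤ 9`, port)]
-/

noncomputable section

-- single-conjunct layout: Sub = Summit, duplicated namespace component intended
set_option linter.dupNamespace false

namespace Summit.ValiantsHypothesis.ValiantsHypothesis.Theorems.GrenetZeon.HeavyTopIrreducibleSThreeFamily

open Matrix

/-! ## The family -/

/-- ★ **`ι(k+4) ≥ C(k+2,2) + 2` for every `k`**: the orbit cone `S₃(k+4) = 𝔫_mid ⊕ ℂ(E_{T,0} − E_{L,B}) ⊕ ℂ(E_{L,T} + E_{B,0})`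
(`Mid = {0,…,k+1}`, `L = k+1`, `T = k+2`, `B = k+3`) is a `C(k+2,2)+2`-dimensional linear space of nilpotent `(k+4) × (k+4)`
complex matrices without a non-trivial proper invariant subspace (val-idea-29 g7 CLAIM ι; crit-7 V37). -/
theorem exists_irreducible_nilpotent_finrank_sThree (k : ℕ) :
    ∃ V : Submodule ℂ (Matrix (Fin (k + 4)) (Fin (k + 4)) ℂ),
      Module.finrank ℂ V = (k + 2).choose 2 + 2 ∧ (∀ A ∈ V, IsNilpotent A) ∧
      ∀ U : Submodule ℂ (Fin (k + 4) → ℂ), (∀ A ∈ V, ∀ x ∈ U, A *ᵥ x ∈ U) → U = ⊥ ∨ U = ⊤ := by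
  classical
  obtain ⟨T, hT⟩ : ∃ T : Fin (k + 4), T.val = k + 2 := ⟨⟨k + 2, by omega⟩, rfl⟩
  obtain ⟨B, hB⟩ : ∃ B : Fin (k + 4), B.val = k + 3 := ⟨⟨k + 3, by omega⟩, rfl⟩
  obtain ⟨L, hL⟩ : ∃ L : Fin (k + 4), L.val = k + 1 := ⟨⟨k + 1, by omega⟩, rfl⟩
  have h0v : (0 : Fin (k + 4)).val = 0 := by simp
  -- the parametrisation `f ↦ N(f) + α c + β v`, `α = f (inl 0)`, `β = f (inl 1)`
  obtain ⟨φ, hφ⟩ : ∃ φ : (Fin 2 ⊕ {p : Fin (k + 2) × Fin (k + 2) // p.1 < p.2} → ℂ) →ₗ[ℂ]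
      Matrix (Fin (k + 4)) (Fin (k + 4)) ℂ, ∀ f i j, φ f i j =
        if h : i.val < j.val ∧ j.val ≤ k + 1 then
          f (Sum.inr ⟨(⟨i.val, by omega⟩, ⟨j.val, by omega⟩), Fin.mk_lt_mk.2 h.1⟩)
        else if i.val = k + 2 ∧ j.val = 0 then f (Sum.inl 0)
        else if i.val = k + 1 ∧ j.val = k + 3 then -f (Sum.inl 0)
        else if i.val = k + 1 ∧ j.val = k + 2 then f (Sum.inl 1)
        else if i.val = k + 3 ∧ j.val = 0 then f (Sum.inl 1)
        else 0 := by
    let F : (Fin 2 ⊕ {p : Fin (k + 2) × Fin (k + 2) // p.1 < p.2} → ℂ) → Matrix (Fin (k + 4)) (Fin (k + 4)) ℂ :=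
      fun f => Matrix.of fun i j =>
        if h : i.val < j.val ∧ j.val ≤ k + 1 then
          f (Sum.inr ⟨(⟨i.val, by omega⟩, ⟨j.val, by omega⟩), Fin.mk_lt_mk.2 h.1⟩)
        else if i.val = k + 2 ∧ j.val = 0 then f (Sum.inl 0)
        else if i.val = k + 1 ∧ j.val = k + 3 then -f (Sum.inl 0)
        else if i.val = k + 1 ∧ j.val = k + 2 then f (Sum.inl 1)
        else if i.val = k + 3 ∧ j.val = 0 then f (Sum.inl 1)
        else 0
    refine ⟨{ toFun := F, map_add' := ?_, map_smul' := ?_ }, fun f i j => rfl⟩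
    · intro f g; ext i j
      simp only [F, Matrix.of_apply, Matrix.add_apply, Pi.add_apply]
      split_ifs <;> ring
    · intro a f; ext i j
      simp only [F, Matrix.of_apply, Matrix.smul_apply, Pi.smul_apply, smul_eq_mul, RingHom.id_apply]
      split_ifs <;> ring
  -- row shapes of `φ f`
  have rowT : ∀ f j, φ f T j = if j = 0 then f (Sum.inl 0) else 0 := by
    intro f j
    rw [hφ, dif_neg (by omega)]
    by_cases hj : j = 0
    · rw [if_pos hj, if_pos ⟨hT, by rw [hj]; exact h0v⟩]
    · have hj' : j.val ≠ 0 := fun e => hj (Fin.ext (by omega))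
      rw [if_neg hj, if_neg (fun h => hj' h.2), if_neg (by omega), if_neg (by omega), if_neg (fun h => hj' h.2)]
  have rowB : ∀ f j, φ f B j = if j = 0 then f (Sum.inl 1) else 0 := by
    intro f j
    rw [hφ, dif_neg (by omega), if_neg (by omega), if_neg (by omega), if_neg (by omega)]
    by_cases hj : j = 0
    · rw [if_pos hj, if_pos ⟨hB, by rw [hj]; exact h0v⟩]
    · have hj' : j.val ≠ 0 := fun e => hj (Fin.ext (by omega))
      rw [if_neg hj, if_neg (fun h => hj' h.2)]
  have rowL : ∀ f j, φ f L j = (if j = T then f (Sum.inl 1) else 0) + (if j = B then -f (Sum.inl 0) else 0) := by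
    intro f j
    have hBT : B ≠ T := fun e => by rw [Fin.ext_iff] at e; omega
    have hTB : T ≠ B := fun e => by rw [Fin.ext_iff] at e; omega
    rw [hφ, dif_neg (by omega), if_neg (by omega)]
    by_cases hjB : j = B
    · rw [hjB, if_pos ⟨hL, hB⟩, if_neg hBT, if_pos rfl]; ring
    · have hjB' : j.val ≠ k + 3 := fun e => hjB (Fin.ext (by omega))
      rw [if_neg (fun h => hjB' h.2)]
      by_cases hjT : j = T
      · rw [hjT, if_pos ⟨hL, hT⟩, if_pos rfl, if_neg hTB]; ring
      · have hjT' : j.val ≠ k + 2 := fun e => hjT (Fin.ext (by omega))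
        rw [if_neg (fun h => hjT' h.2), if_neg (by omega), if_neg hjT, if_neg hjB]; ring
  have rowM : ∀ f (i : Fin (k + 4)), i.val ≤ k → ∀ j, φ f i j =
      if h : i.val < j.val ∧ j.val ≤ k + 1 then
        f (Sum.inr ⟨(⟨i.val, by omega⟩, ⟨j.val, by omega⟩), Fin.mk_lt_mk.2 h.1⟩) else 0 := by
    intro f i hi j
    rw [hφ]
    by_cases hc : i.val < j.val ∧ j.val ≤ k + 1
    · rw [dif_pos hc, dif_pos hc]
    · rw [dif_neg hc, dif_neg hc, if_neg (by omega), if_neg (by omega), if_neg (by omega), if_neg (by omega)]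
  -- the four coordinates of `φ f *ᵥ x`
  have mvT : ∀ f x, (φ f *ᵥ x) T = f (Sum.inl 0) * x 0 := fun f x =>
    mulVec_apply_of_row_eq_ite _ T 0 _ (rowT f) x
  have mvB : ∀ f x, (φ f *ᵥ x) B = f (Sum.inl 1) * x 0 := fun f x =>
    mulVec_apply_of_row_eq_ite _ B 0 _ (rowB f) x
  have mvL : ∀ f x, (φ f *ᵥ x) L = f (Sum.inl 1) * x T + (-f (Sum.inl 0)) * x B := fun f x =>
    mulVec_apply_of_row_eq_add _ L T B _ _ (rowL f) x
  have mvM : ∀ f (i : Fin (k + 4)), i.val ≤ k → ∀ x : Fin (k + 4) → ℂ,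
      (∀ j : Fin (k + 4), i.val < j.val → j.val ≤ k + 1 → x j = 0) → (φ f *ᵥ x) i = 0 := by
    intro f i hi x hx
    apply mulVec_apply_eq_zero_of_row
    intro j
    rw [rowM f i hi j]
    by_cases h : i.val < j.val ∧ j.val ≤ k + 1
    · exact Or.inr (hx j h.1 h.2)
    · exact Or.inl (by rw [dif_neg h])
  -- injectivity of the parametrisation
  have hinj : Function.Injective φ := by
    rw [← LinearMap.ker_eq_bot, LinearMap.ker_eq_bot']
    intro f hf
    have eT : f (Sum.inl 0) = 0 := by
      have h1 := congr_fun (congr_fun hf T) 0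
      rw [rowT] at h1; simpa using h1
    have eB : f (Sum.inl 1) = 0 := by
      have h1 := congr_fun (congr_fun hf B) 0
      rw [rowB] at h1; simpa using h1
    ext p
    rcases p with p | ⟨⟨a, b⟩, hab⟩
    · fin_cases p
      · exact eT
      · exact eB
    · have hab' : a.val < b.val := hab
      have h1 := congr_fun (congr_fun hf ⟨a.val, by omega⟩) ⟨b.val, by omega⟩
      rw [rowM f _ (by simp; omega), dif_pos ⟨by simpa using hab', by simp; omega⟩] at h1
      simpa using h1
  -- middle-block count `#{a<b} = C(k+2,2)` via `Sym2` (adapted from `…AbelianGroupSchurMultiplier.ltPairEquivSym2NotDiag`)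
  have hcard : Fintype.card {p : Fin (k + 2) × Fin (k + 2) // p.1 < p.2} = (k + 2).choose 2 := by
    let e : {p : Fin (k + 2) × Fin (k + 2) // p.1 < p.2} ≃ {z : Sym2 (Fin (k + 2)) // ¬z.IsDiag} :=
      { toFun := fun p => ⟨s(p.1.1, p.1.2), by rw [Sym2.mk_isDiag_iff]; exact ne_of_lt p.2⟩
        invFun := fun z => ⟨(Sym2.sortEquiv z.1).1, lt_of_le_of_ne (Sym2.sortEquiv z.1).2 (by
          obtain ⟨z, hz⟩ := z
          induction z using Sym2.ind with
          | h a b =>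
            intro h
            apply hz
            change a ⊓ b = a ⊔ b at h
            rw [inf_eq_sup] at h
            exact Sym2.mk_isDiag_iff.2 h)⟩
        left_inv := fun p => by
          apply Subtype.ext
          change ((p.1.1 ⊓ p.1.2), (p.1.1 ⊔ p.1.2)) = p.1
          rw [inf_eq_left.2 (le_of_lt p.2), sup_eq_right.2 (le_of_lt p.2)]
        right_inv := fun z => by
          apply Subtype.ext
          change s((Sym2.sortEquiv z.1).1.1, (Sym2.sortEquiv z.1).1.2) = z.1
          rw [← Sym2.sortEquiv_symm_apply, Equiv.symm_apply_apply] }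
    rw [Fintype.card_congr e, Sym2.card_subtype_not_diag, Fintype.card_fin]
  refine ⟨LinearMap.range φ, ?_, ?_, ?_⟩
  · -- dimension
    rw [LinearMap.finrank_range_of_inj hinj, Module.finrank_fintype_fun_eq_card, Fintype.card_sum, Fintype.card_fin,
      hcard, add_comm]
  · -- nilpotency
    rintro A ⟨f, rfl⟩
    exact ⟨k + 4, pow_eq_zero_of_rows k (φ f) (f (Sum.inl 0)) (f (Sum.inl 1)) T B L hT hB hL (mvT f) (mvB f)
      (mvL f) (mvM f)⟩
  · -- irreducibility
    intro U hU
    have hT0 : (0 : Fin (k + 4)) ≠ T := fun e => by rw [Fin.ext_iff] at e; simp at e; omega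
    have hB0 : (0 : Fin (k + 4)) ≠ B := fun e => by rw [Fin.ext_iff] at e; simp at e; omega
    have hL0 : (0 : Fin (k + 4)) ≠ L := fun e => by rw [Fin.ext_iff] at e; simp at e; omega
    have hTB : T ≠ B := fun e => by rw [Fin.ext_iff] at e; omega
    have hTL : T ≠ L := fun e => by rw [Fin.ext_iff] at e; omega
    have hBL : B ≠ L := fun e => by rw [Fin.ext_iff] at e; omega
    -- a vector is determined by its `T`, `B`, `L` and middle coordinates
    have vec_eq : ∀ y z : Fin (k + 4) → ℂ, y T = z T → y B = z B → y L = z L →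
        (∀ i : Fin (k + 4), i.val ≤ k → y i = z i) → y = z := by
      intro y z h1 h2 h3 h4
      ext i
      by_cases e1 : i = T
      · rw [e1]; exact h1
      by_cases e2 : i = B
      · rw [e2]; exact h2
      by_cases e3 : i = L
      · rw [e3]; exact h3
      have e1' : i.val ≠ k + 2 := fun e => e1 (Fin.ext (by omega))
      have e2' : i.val ≠ k + 3 := fun e => e2 (Fin.ext (by omega))
      have e3' : i.val ≠ k + 1 := fun e => e3 (Fin.ext (by omega))
      exact h4 i (by omega)
    -- middle rows of `c`, `v` vanish
    have mvM0 : ∀ (c : Fin 2) (i : Fin (k + 4)), i.val ≤ k → ∀ x : Fin (k + 4) → ℂ,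
        (φ (Pi.single (Sum.inl c) 1) *ᵥ x) i = 0 := by
      intro c i hi x
      apply mulVec_apply_eq_zero_of_row
      intro j
      left
      rw [rowM _ i hi j]
      split_ifs <;> simp
    -- the middle matrix units
    have mvE : ∀ (a b : Fin (k + 4)) (hab : a.val < b.val) (hb : b.val ≤ k + 1) (x : Fin (k + 4) → ℂ),
        φ (Pi.single (Sum.inr ⟨(⟨a.val, by omega⟩, ⟨b.val, by omega⟩), Fin.mk_lt_mk.2 hab⟩) 1) *ᵥ x =
          x b • (Pi.single a (1 : ℂ) : Fin (k + 4) → ℂ) := by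
      intro a b hab hb x
      have ha : a.val ≤ k := by omega
      have haT : T ≠ a := fun e => by rw [Fin.ext_iff] at e; omega
      have haB : B ≠ a := fun e => by rw [Fin.ext_iff] at e; omega
      have haL : L ≠ a := fun e => by rw [Fin.ext_iff] at e; omega
      symm
      apply vec_eq
      · rw [mvT]; simp [haT]
      · rw [mvB]; simp [haB]
      · rw [mvL]; simp [haL]
      · intro i hi
        by_cases hia : i = a
        · subst hia
          rw [mulVec_apply_of_row_eq_ite _ i b 1 ?_ x]
          · simp
          · intro j
            rw [rowM _ i hi j]
            by_cases hjb : j = b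
            · subst hjb
              rw [dif_pos ⟨hab, hb⟩, if_pos rfl]
              simp
            · have hjb' : j.val ≠ b.val := fun e => hjb (Fin.ext e)
              rw [if_neg hjb]
              split_ifs
              · simp [hjb']
              · rfl
        · have hia' : i.val ≠ a.val := fun e => hia (Fin.ext e)
          rw [mulVec_apply_eq_zero_of_row]
          · simp [hia]
          · intro j
            left
            rw [rowM _ i hi j]
            split_ifs
            · simp [hia']
            · rfl
    refine eq_bot_or_eq_top_of_stable k U T B L hT hB hL ?_ ?_ ?_
    · -- `c = φ (e_{inl 0})`: `x ↦ x_0 e_T − x_B e_L`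
      intro x hx
      have h1 := hU (φ (Pi.single (Sum.inl 0) 1)) (LinearMap.mem_range_self φ _) x hx
      convert h1 using 1
      apply vec_eq
      · rw [mvT]; simp [hTL]
      · rw [mvB]; simp [hTB.symm, hBL]
      · rw [mvL]; simp [hTL.symm]
      · intro i hi
        have hiT : i ≠ T := fun e => by rw [Fin.ext_iff] at e; omega
        have hiL : i ≠ L := fun e => by rw [Fin.ext_iff] at e; omega
        rw [mvM0 0 i hi x]; simp [hiT, hiL]
    · -- `v = φ (e_{inl 1})`: `x ↦ x_T e_L + x_0 e_B`
      intro x hx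
      have h1 := hU (φ (Pi.single (Sum.inl 1) 1)) (LinearMap.mem_range_self φ _) x hx
      convert h1 using 1
      apply vec_eq
      · rw [mvT]; simp [hTL, hTB]
      · rw [mvB]; simp [hBL]
      · rw [mvL]; simp [hBL.symm]
      · intro i hi
        have hiB : i ≠ B := fun e => by rw [Fin.ext_iff] at e; omega
        have hiL : i ≠ L := fun e => by rw [Fin.ext_iff] at e; omega
        rw [mvM0 1 i hi x]; simp [hiB, hiL]
    · -- the middle units `E_{ab} = φ (e_{inr (a,b)})`
      intro a b hab hb x hx
      have h1 := hU _ (LinearMap.mem_range_self φ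
        (Pi.single (Sum.inr ⟨(⟨a.val, by omega⟩, ⟨b.val, by omega⟩), Fin.mk_lt_mk.2 hab⟩) 1)) x hx
      rwa [mvE a b hab hb x] at h1

/-! ## Every `m ≥ 4`, and the instances `m = 8, …, 12` -/

/-- ★ **`ι(m) ≥ C(m−2,2) + 2` for every `m ≥ 4`**: an irreducible `C(m−2,2)+2`-dimensional linear space of nilpotent `m × m`
complex matrices exists (the orbit cone `S₃(m)`; `m = k + 4` in `exists_irreducible_nilpotent_finrank_sThree`).  At `m = 5, 6, 7`
this ties the kernel records `5, 8, 12` (✓ `…HeavyTopIrreducibleFive`, ✓ `…SixEight`, ✓ `…SevenTwelve`); from `m = 8` on it is new. -/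
theorem exists_irreducible_nilpotent_finrank_choose (m : ℕ) (hm : 4 ≤ m) :
    ∃ V : Submodule ℂ (Matrix (Fin m) (Fin m) ℂ),
      Module.finrank ℂ V = (m - 2).choose 2 + 2 ∧ (∀ A ∈ V, IsNilpotent A) ∧
      ∀ U : Submodule ℂ (Fin m → ℂ), (∀ A ∈ V, ∀ x ∈ U, A *ᵥ x ∈ U) → U = ⊥ ∨ U = ⊤ := by
  obtain ⟨k, rfl⟩ : ∃ k, m = k + 4 := ⟨m - 4, by omega⟩
  have h : k + 4 - 2 = k + 2 := by omega
  rw [h]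
  exact exists_irreducible_nilpotent_finrank_sThree k

/-- **Corollary**: the hypothesis shape «every irreducible nilpotent subspace of `M_m(ℂ)` has dimension `≤ C(m−2,2) + 1`» is
FALSE for every `m ≥ 4`; composition rows of the heavy-top instance table may not assume it. -/
theorem not_iota_le_choose (m : ℕ) (hm : 4 ≤ m) :
    ¬ ∀ V : Submodule ℂ (Matrix (Fin m) (Fin m) ℂ), (∀ A ∈ V, IsNilpotent A) →
      (∀ U : Submodule ℂ (Fin m → ℂ), (∀ A ∈ V, ∀ x ∈ U, A *ᵥ x ∈ U) → U = ⊥ ∨ U = ⊤) →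
      Module.finrank ℂ V ≤ (m - 2).choose 2 + 1 := by
  intro h
  obtain ⟨V, hd, hnil, hirr⟩ := exists_irreducible_nilpotent_finrank_choose m hm
  have := h V hnil hirr
  omega

/-- `ι(8) ≥ 17`: an irreducible `17`-dimensional nilpotent subspace of `M₈(ℂ)` (`S₃(8)`; the kernel had `13`, ✓ p678548/p679118). -/
theorem exists_irreducible_nilpotent_finrank_eight_seventeen :
    ∃ V : Submodule ℂ (Matrix (Fin 8) (Fin 8) ℂ), Module.finrank ℂ V = 17 ∧ (∀ A ∈ V, IsNilpotent A) ∧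
      ∀ U : Submodule ℂ (Fin 8 → ℂ), (∀ A ∈ V, ∀ x ∈ U, A *ᵥ x ∈ U) → U = ⊥ ∨ U = ⊤ := by
  obtain ⟨V, hV, hnil, hirr⟩ := exists_irreducible_nilpotent_finrank_choose 8 (by norm_num)
  exact ⟨V, by rw [hV]; decide, hnil, hirr⟩

/-- `ι(9) ≥ 23`: an irreducible `23`-dimensional nilpotent subspace of `M₉(ℂ)` (`S₃(9)`; the kernel had `19`, ✓ p680271). -/
theorem exists_irreducible_nilpotent_finrank_nine_twentyThree :
    ∃ V : Submodule ℂ (Matrix (Fin 9) (Fin 9) ℂ), Module.finrank ℂ V = 23 ∧ (∀ A ∈ V, IsNilpotent A) ∧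
      ∀ U : Submodule ℂ (Fin 9 → ℂ), (∀ A ∈ V, ∀ x ∈ U, A *ᵥ x ∈ U) → U = ⊥ ∨ U = ⊤ := by
  obtain ⟨V, hV, hnil, hirr⟩ := exists_irreducible_nilpotent_finrank_choose 9 (by norm_num)
  exact ⟨V, by rw [hV]; decide, hnil, hirr⟩

/-- `ι(10) ≥ 30`: an irreducible `30`-dimensional nilpotent subspace of `M₁₀(ℂ)` (`S₃(10)`; the kernel had `21`, ✓ p682815). -/
theorem exists_irreducible_nilpotent_finrank_ten_thirty :
    ∃ V : Submodule ℂ (Matrix (Fin 10) (Fin 10) ℂ), Module.finrank ℂ V = 30 ∧ (∀ A ∈ V, IsNilpotent A) ∧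
      ∀ U : Submodule ℂ (Fin 10 → ℂ), (∀ A ∈ V, ∀ x ∈ U, A *ᵥ x ∈ U) → U = ⊥ ∨ U = ⊤ := by
  obtain ⟨V, hV, hnil, hirr⟩ := exists_irreducible_nilpotent_finrank_choose 10 (by norm_num)
  exact ⟨V, by rw [hV]; decide, hnil, hirr⟩

/-- `ι(11) ≥ 38`: an irreducible `38`-dimensional nilpotent subspace of `M₁₁(ℂ)` (`S₃(11)`; the kernel had `26`, W(11)). -/
theorem exists_irreducible_nilpotent_finrank_eleven_thirtyEight :
    ∃ V : Submodule ℂ (Matrix (Fin 11) (Fin 11) ℂ), Module.finrank ℂ V = 38 ∧ (∀ A ∈ V, IsNilpotent A) ∧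
      ∀ U : Submodule ℂ (Fin 11 → ℂ), (∀ A ∈ V, ∀ x ∈ U, A *ᵥ x ∈ U) → U = ⊥ ∨ U = ⊤ := by
  obtain ⟨V, hV, hnil, hirr⟩ := exists_irreducible_nilpotent_finrank_choose 11 (by norm_num)
  exact ⟨V, by rw [hV]; decide, hnil, hirr⟩

/-- `ι(12) ≥ 47`: an irreducible `47`-dimensional nilpotent subspace of `M₁₂(ℂ)` (`S₃(12)`; no kernel datum before). -/
theorem exists_irreducible_nilpotent_finrank_twelve_fortySeven :
    ∃ V : Submodule ℂ (Matrix (Fin 12) (Fin 12) ℂ), Module.finrank ℂ V = 47 ∧ (∀ A ∈ V, IsNilpotent A) ∧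
      ∀ U : Submodule ℂ (Fin 12 → ℂ), (∀ A ∈ V, ∀ x ∈ U, A *ᵥ x ∈ U) → U = ⊥ ∨ U = ⊤ := by
  obtain ⟨V, hV, hnil, hirr⟩ := exists_irreducible_nilpotent_finrank_choose 12 (by norm_num)
  exact ⟨V, by rw [hV]; decide, hnil, hirr⟩

/-- «`ι(8) ≤ 16`» is false. -/
theorem not_iota_8_le_16 :
    ¬ ∀ V : Submodule ℂ (Matrix (Fin 8) (Fin 8) ℂ), (∀ A ∈ V, IsNilpotent A) →
      (∀ U : Submodule ℂ (Fin 8 → ℂ), (∀ A ∈ V, ∀ x ∈ U, A *ᵥ x ∈ U) → U = ⊥ ∨ U = ⊤) →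
      Module.finrank ℂ V ≤ 16 := by
  intro h
  obtain ⟨V, hd, hnil, hirr⟩ := exists_irreducible_nilpotent_finrank_eight_seventeen
  have := h V hnil hirr
  omega

/-- «`ι(9) ≤ 22`» is false. -/
theorem not_iota_9_le_22 :
    ¬ ∀ V : Submodule ℂ (Matrix (Fin 9) (Fin 9) ℂ), (∀ A ∈ V, IsNilpotent A) →
      (∀ U : Submodule ℂ (Fin 9 → ℂ), (∀ A ∈ V, ∀ x ∈ U, A *ᵥ x ∈ U) → U = ⊥ ∨ U = ⊤) →
      Module.finrank ℂ V ≤ 22 := by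
  intro h
  obtain ⟨V, hd, hnil, hirr⟩ := exists_irreducible_nilpotent_finrank_nine_twentyThree
  have := h V hnil hirr
  omega

/-- «`ι(10) ≤ 29`» is false. -/
theorem not_iota_10_le_29 :
    ¬ ∀ V : Submodule ℂ (Matrix (Fin 10) (Fin 10) ℂ), (∀ A ∈ V, IsNilpotent A) →
      (∀ U : Submodule ℂ (Fin 10 → ℂ), (∀ A ∈ V, ∀ x ∈ U, A *ᵥ x ∈ U) → U = ⊥ ∨ U = ⊤) →
      Module.finrank ℂ V ≤ 29 := by
  intro h
  obtain ⟨V, hd, hnil, hirr⟩ := exists_irreducible_nilpotent_finrank_ten_thirty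
  have := h V hnil hirr
  omega

/-- «`ι(11) ≤ 37`» is false. -/
theorem not_iota_11_le_37 :
    ¬ ∀ V : Submodule ℂ (Matrix (Fin 11) (Fin 11) ℂ), (∀ A ∈ V, IsNilpotent A) →
      (∀ U : Submodule ℂ (Fin 11 → ℂ), (∀ A ∈ V, ∀ x ∈ U, A *ᵥ x ∈ U) → U = ⊥ ∨ U = ⊤) →
      Module.finrank ℂ V ≤ 37 := by
  intro h
  obtain ⟨V, hd, hnil, hirr⟩ := exists_irreducible_nilpotent_finrank_eleven_thirtyEight
  have := h V hnil hirr
  omega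

/-- «`ι(12) ≤ 46`» is false. -/
theorem not_iota_12_le_46 :
    ¬ ∀ V : Submodule ℂ (Matrix (Fin 12) (Fin 12) ℂ), (∀ A ∈ V, IsNilpotent A) →
      (∀ U : Submodule ℂ (Fin 12 → ℂ), (∀ A ∈ V, ∀ x ∈ U, A *ᵥ x ∈ U) → U = ⊥ ∨ U = ⊤) →
      Module.finrank ℂ V ≤ 46 := by
  intro h
  obtain ⟨V, hd, hnil, hirr⟩ := exists_irreducible_nilpotent_finrank_twelve_fortySeven
  have := h V hnil hirr
  omega

end Summit.ValiantsHypothesis.ValiantsHypothesis.Theorems.GrenetZeon.HeavyTopIrreducibleSThreeFamily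

end
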